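import Summits.HodgeConjecture.HodgeConjecture.Theorems.VHCAbelianSchemesRoadMoverFamilyOfConfined
import Summits.HodgeConjecture.HodgeConjecture.Theorems.VHCAbelianSchemesRoadMoverTrapDefs
import Literature.AlgebraicGeometry.Motives.AbelianVarietyKerComponentDimZero
import Mathlib.Data.ZMod.QuotientGroup
import HarnessLib

/-!
# Road №4 (`VHCAbelianSchemesRoad`) — THE ψ̄-STABLE CORE IS FINITE AT A K-SIMPLE DATUM: step (L-A) of stub (S2) `stub_moverConfinement_of_KSimple`
# of line `mover-trap` (crux stmt-HodgeConjecture-26512; k0 memo `Cruxes/DiagLocalOfMarkmanPinnedForall/Lines/MoverTrap-S2-K0.md` §3)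

research route conditional on HC_CM; not a corollary; Q11.4-sentence-2 already refuted in dim ≥ 3.

PROOFS ONLY (core-w5 gen 3, width copy of seat core-D; helper `--supports stmt-HodgeConjecture-26512`; `HC_CM` nowhere; ZERO new named facts;
nothing about any cell, stub of `birth.lean`, crux, carrier, `HC_AV` or HC is asserted). The card's «`B̃ ∩ φ_d⁻¹B̃` is finite» step of (S2),
re-sited to the secant quotient `Y` (memo §2): for a secant–quotient datum `D` which is K-SIMPLE (`MoverTrap.KSimple D`: `J × Ĵ` has no
`φ_d`-stable abelian subvariety of dimension strictly between `0` and `6`), the descent `ψ̄` of `φ_d` to `Y` (`q ≫ ψ̄ = φ_d ≫ q`), a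
homomorphism `g : C → Y` of abelian varieties which is NOT surjective on complex points, and a torsion point `t ∈ Y(ℂ)`, the set of
`y ∈ H := ⟨t⟩ · g(C(ℂ))` with `ψ̄ y ∈ H` is FINITE (`SecantQuotientDatum.finite_psiBarStableCore`). Proof (memo A1–A5): A1 a COFINITE
ANNIHILATOR `π : Y → Z` of the proper abelian subvariety `g(C)` — `π ≠ 0`, `g ≫ π = 0`, `Ker π(ℂ) ⊆ [N]⁻¹ g(C(ℂ))` — taken here as a
HYPOTHESIS `hπ` of exactly the frozen shape of the Literature lemma `AbelianVariety.exists_cofinite_annihilator_of_range_ne_univ` (piece P1 of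
the cut, another hand's file; the unconditional corollary is one `obtain` away and lands when P1 does); A2 the intertwined pair
`Π := (π, ψ̄ ≫ π) : Y → Z × Z`, `Π_P := q ≫ Π`, with `φ_d ≫ Π_P = Π_P ≫ v`, `v(z₁, z₂) = (z₂, −d z₁)` (because `ψ̄² = −d`); A3 the identity
component `W := (Ker Π_P)⁰_red ↪ J × Ĵ` (`Motives/PrymVariety`) is a CLOSED, `φ_d`-STABLE (`kerComponentRestrict_ι`) abelian subvariety of
dimension `< 6` (`dim_kerComponent_lt`), so K-simplicity forces `dim W = 0`; A4 hence `Ker Π_P(ℂ)` and `Ker Π(ℂ) = q(Ker Π_P(ℂ))` are finite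
(`Motives/AbelianVarietyKerComponentDimZero`); A5 on the set in question `y ↦ (π y, π(ψ̄ y))` takes finitely many values (`π` kills `g(C)`,
`⟨t⟩` is finite) with fibres inside translates of `Ker Π(ℂ)`.

Nothing here says (S2), (c4a-E), (c4a), any stub of `birth.lean`, 26512, 26511, №4, `HC_AV`, `HC_CM` or HC holds; HC_CM HELD, by name only.

References: [cite: Raynaud1983SousVarietes, Théorème principal (p. 327)] [cite: MumfordAV1970, §19 Thm. 1 and Cor. 2 (pp. 173–174)]
[cite: BirkenhakeLange2004, §5.3 and §13.4] [cite: GortzWedhorn2023, Def./Prop. 27.12 and Lemma 27.13].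
-/

noncomputable section

universe u

open CategoryTheory CategoryTheory.Limits AlgebraicGeometry

namespace Summit.HodgeConjecture.HodgeConjecture.Ring2.SemiregularRepresentatives

set_option linter.dupNamespace false -- the cell's namespace repeats the summit name, as in every `Ring2*` file

open Literature.AlgebraicGeometry Literature.AlgebraicGeometry.Motives Literature.AlgebraicGeometry.Motives.AbelianVariety
open Literature.AlgebraicGeometry.HodgeTheory Literature.AlgebraicGeometry.Markman2025

/-! ## §1 Points arithmetic: the zero homomorphism, products -/

/-- On `L`-points the zero homomorphism is constant `1`. [cite: GortzWedhorn2023, (27.35.1)] -/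
theorem pointsMap_zero_apply {K : Type u} [Field K] {P Q : AbelianVariety K} (L : Type u) [Field L] [Algebra K L]
    (y : P.Points L) : pointsMap L (0 : P ⟶ Q) y = 1 := by
  have h : (0 : P ⟶ Q) = 0 - 0 := (sub_self 0).symm
  rw [h, pointsMap_sub, mul_inv_cancel]

/-- On `L`-points, the pairing `(f, g) : T → A × B` has projections `f` and `g`. [cite: Milne1986AbelianVarieties, Conventions p. 103] -/
theorem pointsProj_pointsMap_prodLift {K : Type u} [Field K] {T A B : AbelianVariety K} (L : Type u) [Field L] [Algebra K L]
    (f : T ⟶ A) (g : T ⟶ B) (y : T.Points L) :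
    A.pointsProj B L (pointsMap L (prodLift f g) y) = (pointsMap L f y, pointsMap L g y) := by
  rw [pointsProj_apply, ← prodLift_fst f g, ← prodLift_snd f g, pointsMap_comp_apply, pointsMap_comp_apply, prodLift_fst,
    prodLift_snd]
  rfl

/-- On `L`-points, `(f, g)(y) = 1 ↔ f(y) = 1 ∧ g(y) = 1`. [cite: Milne1986AbelianVarieties, Conventions p. 103] -/
theorem pointsMap_prodLift_eq_one_iff {K : Type u} [Field K] {T A B : AbelianVariety K} (L : Type u) [Field L] [Algebra K L]
    (f : T ⟶ A) (g : T ⟶ B) (y : T.Points L) :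
    pointsMap L (prodLift f g) y = 1 ↔ pointsMap L f y = 1 ∧ pointsMap L g y = 1 := by
  rw [← (A.pointsProj_injective B L).eq_iff, pointsProj_pointsMap_prodLift, map_one, Prod.mk_eq_one]

namespace SecantQuotientDatum

variable (D : SecantQuotientDatum)

/-! ## §2 `ψ̄`, the descent of `φ_d` to `Y`: `ψ̄ ≫ ψ̄ = −d` -/

/-- **`ψ̄² = −d` on `Y`** for any descent `ψ̄` of `φ_d` (`q ≫ ψ̄ = φ_d ≫ q`): `q` is an epimorphism of abelian varieties and `φ_d² = −d`.
[cite: Markman2025SecantWeil, §3.2] [cite: GortzWedhorn2023, Prop. 27.178 (1)] -/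
theorem psiBar_comp_psiBar' {ψbar : D.Y ⟶ D.Y} (h : D.q ≫ ψbar = D.ψ ≫ D.q) : ψbar ≫ ψbar = -((D.d : ℤ) • 𝟙 D.Y) := by
  apply D.isIsogeny_q.cancel_left
  rw [← Category.assoc, h, Category.assoc, h, ← Category.assoc, D.ψ_comp_ψ, Preadditive.neg_comp, Preadditive.comp_neg,
    Preadditive.zsmul_comp, Preadditive.comp_zsmul, Category.id_comp, Category.comp_id]

/-! ## §3 The ψ̄-stable core is finite at a K-simple datum (memo A2–A5 over the cofinite annihilator A1) -/

/-- **(L-A) over a given cofinite annihilator.** At a K-simple datum, for a descent `ψ̄` of `φ_d` to `Y`, a homomorphism `g : C → Y`, a torsion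
point `t ∈ Y(ℂ)`, and a homomorphism `π : Y → Z` with `π ≠ 0` killing `g` whose kernel on `ℂ`-points lies in `[N]⁻¹ g(C(ℂ))`... — only
`π ≠ 0` and `g ≫ π = 0` are used here — the set `{y ∈ ⟨t⟩·g(C(ℂ)) | ψ̄ y ∈ ⟨t⟩·g(C(ℂ))}` is finite. Proof: memo A2 (`Π := (π, ψ̄ ≫ π)`,
`Π_P := q ≫ Π`, `φ_d ≫ Π_P = Π_P ≫ v`), A3 (`(Ker Π_P)⁰_red` is a closed `φ_d`-stable abelian subvariety of dimension `< 6`, hence `0` by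
K-simplicity), A4 (`Ker Π(ℂ)` finite), A5 (fibres of `y ↦ (π y, π ψ̄ y)`). [cite: MumfordAV1970, §19 Thm. 1 and Cor. 2 (pp. 173–174)]
[cite: BirkenhakeLange2004, §5.3 and §13.4] [cite: GortzWedhorn2023, Lemma 27.13] -/
theorem finite_psiBarStableCore_of_annihilator (hK : MoverTrap.KSimple D) {ψbar : D.Y ⟶ D.Y} (hψbar : D.q ≫ ψbar = D.ψ ≫ D.q)
    {C : AbelianVariety ℂ} (g : C ⟶ D.Y) (t : D.Y.Points ℂ) (ht : IsOfFinOrder t)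
    {Z : AbelianVariety ℂ} (π : D.Y ⟶ Z) (hπ0 : π ≠ 0) (hgπ : g ≫ π = 0) :
    {y : D.Y.Points ℂ | y ∈ Subgroup.zpowers t ⊔ (pointsMap ℂ g).range ∧
      pointsMap ℂ ψbar y ∈ Subgroup.zpowers t ⊔ (pointsMap ℂ g).range}.Finite := by
  classical
  -- A2: the intertwined pair
  have hψ2 : ψbar ≫ ψbar = -((D.d : ℤ) • 𝟙 D.Y) := D.psiBar_comp_psiBar' hψbar
  obtain ⟨v, hv⟩ : ∃ v : Z.prod Z ⟶ Z.prod Z, v = prodLift (snd Z Z) (-((D.d : ℤ) • fst Z Z)) := ⟨_, rfl⟩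
  obtain ⟨Pr, hPr⟩ : ∃ Pr : D.Y ⟶ Z.prod Z, Pr = prodLift π (ψbar ≫ π) := ⟨_, rfl⟩
  have hPrv : ψbar ≫ Pr = Pr ≫ v := by
    rw [hPr, hv]
    apply prod_hom_ext
    · simp only [Category.assoc, prodLift_fst, prodLift_snd]
    · simp only [Category.assoc, prodLift_fst, prodLift_snd, Preadditive.comp_neg, Preadditive.comp_zsmul]
      rw [← Category.assoc, hψ2, Preadditive.neg_comp, Preadditive.zsmul_comp, Category.id_comp]
  obtain ⟨PrP, hPrP⟩ : ∃ PrP : D.P ⟶ Z.prod Z, PrP = D.q ≫ Pr := ⟨_, rfl⟩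
  have hPrPv : D.ψ ≫ PrP = PrP ≫ v := by
    rw [hPrP, ← Category.assoc, ← hψbar, Category.assoc, hPrv, Category.assoc]
  have hPr0 : Pr ≠ 0 := fun h => hπ0 (by rw [← prodLift_fst π (ψbar ≫ π), ← hPr, h, zero_comp])
  have hPrP0 : PrP ≠ 0 := by
    intro h
    haveI := D.isIsogeny_q.epi
    exact hPr0 ((cancel_epi D.q).1 (by rw [← hPrP, h, comp_zero]))
  -- A3: the identity component of `Ker Π_P` is a closed `φ_d`-stable abelian subvariety of dimension `< 6`, hence `0`
  have hstable : MoverTrap.IsPsiStable D (kerComponentι PrP) :=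
    ⟨kerComponentRestrict PrP D.ψ v hPrPv, kerComponentRestrict_ι PrP D.ψ v hPrPv⟩
  have hdim0 : (kerComponent PrP).dim = 0 := by
    by_contra hne
    exact hK (kerComponent PrP) (kerComponentι PrP) inferInstance hstable (Nat.pos_of_ne_zero hne) (dim_kerComponent_lt PrP hPrP0)
  -- A4: `Ker Π_P(ℂ)` and `Ker Π(ℂ)` are finite
  have hkerP : (Hom.kerPoints (specOver ℂ ℂ) PrP : Set (D.P.Points ℂ)).Finite :=
    kerPoints_finite_of_dim_kerComponent_eq_zero PrP hdim0
  set Kset : Set (D.Y.Points ℂ) := {k | pointsMap ℂ π k = 1 ∧ pointsMap ℂ π (pointsMap ℂ ψbar k) = 1} with hKset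
  have hKfin : Kset.Finite := by
    refine (hkerP.image (pointsMap ℂ D.q)).subset fun k hk => ?_
    obtain ⟨y, rfl⟩ := pointsMap_surjective D.q D.isIsogeny_q.1 k
    refine ⟨y, (Hom.mem_kerPoints_iff _ _).2 ?_, rfl⟩
    change pointsMap ℂ PrP y = 1
    rw [hPrP, pointsMap_comp_apply, hPr, pointsMap_prodLift_eq_one_iff, pointsMap_comp_apply]
    exact hk
  -- A5: the values of `(π, π ∘ ψ̄)` on the set lie in the finite `F × F`, `F := π(⟨t⟩)`, with fibres in translates of `Kset`
  set F : Set (Z.Points ℂ) := pointsMap ℂ π '' (Subgroup.zpowers t : Set (D.Y.Points ℂ)) with hF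
  have hFfin : F.Finite := ht.finite_zpowers.image _
  have hkill : ∀ y ∈ Subgroup.zpowers t ⊔ (pointsMap ℂ g).range, pointsMap ℂ π y ∈ F := by
    intro y hy
    obtain ⟨a, ha, b, ⟨c, rfl⟩, rfl⟩ := Subgroup.mem_sup.1 hy
    refine ⟨a, ha, ?_⟩
    rw [map_mul, ← pointsMap_comp_apply, hgπ, pointsMap_zero_apply, mul_one]
  set T : Z.Points ℂ → Z.Points ℂ → Set (D.Y.Points ℂ) :=
    fun a b => {y | pointsMap ℂ π y = a ∧ pointsMap ℂ π (pointsMap ℂ ψbar y) = b} with hT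
  have hTfin : ∀ a b, (T a b).Finite := by
    intro a b
    by_cases hne : (T a b).Nonempty
    · obtain ⟨y₀, hy₀a, hy₀b⟩ := hne
      refine (hKfin.image fun k => y₀ * k).subset fun y hy => ?_
      obtain ⟨hya, hyb⟩ := hy
      refine ⟨y₀⁻¹ * y, ⟨?_, ?_⟩, by beta_reduce; rw [mul_inv_cancel_left]⟩
      · rw [map_mul, map_inv, hy₀a, hya, inv_mul_cancel]
      · rw [map_mul, map_inv, map_mul, map_inv, hy₀b, hyb, inv_mul_cancel]
    · rw [Set.not_nonempty_iff_eq_empty.1 hne]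
      exact Set.finite_empty
  refine ((hFfin.biUnion fun a _ => hFfin.biUnion fun b _ => hTfin a b)).subset fun y hy => ?_
  obtain ⟨hy₁, hy₂⟩ := hy
  simp only [Set.mem_iUnion]
  exact ⟨_, hkill _ hy₁, _, hkill _ hy₂, rfl, rfl⟩

/-- **(L-A) — THE ψ̄-STABLE CORE IS FINITE AT A K-SIMPLE DATUM** (k0 memo §3, FROZEN signature, over the cofinite-annihilator input of shape
`AbelianVariety.exists_cofinite_annihilator_of_range_ne_univ` (piece P1), supplied as the hypothesis `hA1`): for `g : C → Y` NOT surjective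
on complex points and a torsion point `t`, `{y ∈ ⟨t⟩·g(C(ℂ)) | ψ̄ y ∈ ⟨t⟩·g(C(ℂ))}` is finite.
[cite: MumfordAV1970, §19 Thm. 1 and Cor. 2 (pp. 173–174)] [cite: BirkenhakeLange2004, §5.3 and §13.4] [cite: Raynaud1983SousVarietes, Théorème principal (p. 327)] -/
theorem finite_psiBarStableCore_of_exists_annihilator (hK : MoverTrap.KSimple D) {ψbar : D.Y ⟶ D.Y} (hψbar : D.q ≫ ψbar = D.ψ ≫ D.q)
    {C : AbelianVariety ℂ} (g : C ⟶ D.Y)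
    (hA1 : ∃ (Z : AbelianVariety ℂ) (π : D.Y ⟶ Z) (N : ℕ), π ≠ 0 ∧ g ≫ π = 0 ∧ 0 < N ∧
      ∀ y : D.Y.Points ℂ, pointsMap ℂ π y = 1 → y ^ N ∈ Set.range (pointsMap ℂ g))
    (t : D.Y.Points ℂ) (ht : IsOfFinOrder t) :
    {y : D.Y.Points ℂ | y ∈ Subgroup.zpowers t ⊔ (pointsMap ℂ g).range ∧
      pointsMap ℂ ψbar y ∈ Subgroup.zpowers t ⊔ (pointsMap ℂ g).range}.Finite := by
  obtain ⟨Z, π, -, hπ0, hgπ, -, -⟩ := hA1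
  exact D.finite_psiBarStableCore_of_annihilator hK hψbar g t ht π hπ0 hgπ

end SecantQuotientDatum

end Summit.HodgeConjecture.HodgeConjecture.Ring2.SemiregularRepresentatives

end
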